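import Summits.HubbardSuperconductivity.HubbardSuperconductivity.Theorems.AnisotropyChordTransferFibre3Invertible
import Summits.HubbardSuperconductivity.HubbardSuperconductivity.Theorems.AnisotropyChordTransferFibre3Equivariance
import Summits.HubbardSuperconductivity.HubbardSuperconductivity.Theorems.AnisotropyChordTransferFibre3PoleGap
import Summits.HubbardSuperconductivity.HubbardSuperconductivity.Theorems.AnisotropyChordTransferFibre3Shell
import Summits.HubbardSuperconductivity.HubbardSuperconductivity.Theorems.AnisotropyChordTransferFibre3KreinJF

/-!
# Route `AnisotropyChord` / H0 rotor rung: the hard-core (Dirichlet) resolvent `G^D_T` and the LADDER TERM of the master inequality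

Memo ROTOR-THEORY-20 §283(a), §284(b), §290(b) (theory seat `hubbard-h0-rotor-theory-1`, cycle 20) in the fibre model of
`…TransferFibre3`.  For `T < 2ε₁`, `L ≥ 4` and any function `R` on the fibre let `e_D := (G_T R)|_D`, `u := P⁻¹ e_D`
(`P = (G_T)_{DD}`, invertible by `det_P_ne_zero`), `z :=` the charge `u` on `D` extended by zero, and
`Y := G^D_T R := G_T (R − z)` (Krein's formula for the resolvent with Dirichlet condition on the hard core).  Then
* `GDapply_D`: `Y` vanishes on `D`;  `ip_poleWave_GDapply`: `Y ⟂` the three pole waves;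
* `GDapply_S_eq`: on the shell, `Y_s = (G_T R)_s − (B P⁻¹ e_D)_s` — the Schur-reduced saddle residual of `…Fibre3Saddle`;
* `ip_GD_H0E`: `⟨Y, (H₀ − E)Y⟩ = ⟨Y, R⟩`, and `re_ip_GD_R_le`: `Re⟨Y, R⟩ = Re G[R,R] − Re⟨u, P u⟩ ≤ Re G[R,R]` (`G^D ≤ G`);
* **`ladder_bound`** (LEMMA §284(b) with the sharp factor `κ_E` of §290(b)): for `0 ≤ ε₁ + T`, `0 ≤ Δ`,
  `Σ_S ΔW|Y|² ≤ Δ·(3ε₁/(2ε₁ − T))·Re⟨Y, R⟩` — from `ShellDirichletBound` and `PoleComplementGap` (both landed).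
Prover seat `hubbard-h0-rotor-p1` g22; helper for stmt-HubbardSuperconductivity-19089 (`--supports`).
-/

set_option linter.dupNamespace false
set_option autoImplicit false

noncomputable section

open scoped BigOperators
open Complex Matrix

namespace Summit.HubbardSuperconductivity.HubbardSuperconductivity.Theorems.AnisotropyChord.Transfer.Fibre3

variable (L : ℕ) [NeZero L]

/-! ## The objects -/

/-- the hard-core trace of the resolvent-smoothed function: `e_D(d) = (G_T R)(d)`. [folklore] -/
def traceD (T : ℝ) (R : Cfg L → ℂ) : Dsub L → ℂ := fun d => Gapply L T R d.1

/-- the Krein correction charge `u = P⁻¹ e_D`. [folklore] -/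
def kreinU (T : ℝ) (R : Cfg L → ℂ) : Dsub L → ℂ := (Pmat L T)⁻¹ *ᵥ traceD L T R

/-- the Krein correction charge extended by zero to the fibre. [folklore] -/
def kreinZ (T : ℝ) (R : Cfg L → ℂ) : Cfg L → ℂ := extD L (kreinU L T R)

/-- the hard-core (Dirichlet) resolvent applied to `R`: `G^D_T R = G_T (R − z)` (Krein's formula). [folklore] -/
def GDapply (T : ℝ) (R : Cfg L → ℂ) : Cfg L → ℂ := Gapply L T (fun c => R c - kreinZ L T R c)

/-! ## Resolvent of a `D`-supported charge -/

/-- `G_T` of a charge supported on `D` is a sum over `D`. [folklore] -/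
theorem Gapply_extD (T : ℝ) (u : Dsub L → ℂ) (c : Cfg L) :
    Gapply L T (extD L u) c = ∑ d : Dsub L, Gentry L T c d.1 * u d := by
  classical
  unfold Gapply
  have h1 : ∑ c' : Cfg L, Gentry L T c c' * extD L u c'
      = ∑ c' ∈ Finset.univ.filter (fun c' : Cfg L => InD L c' = true), Gentry L T c c' * extD L u c' := by
    rw [Finset.sum_filter]
    refine Finset.sum_congr rfl fun c' _ => ?_
    unfold extD
    split_ifs <;> simp
  rw [h1, Finset.sum_subtype (Finset.univ.filter fun c' : Cfg L => InD L c' = true) (p := fun c' => InD L c' = true)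
    (by intro c'; simp)]
  refine Finset.sum_congr rfl fun d _ => ?_
  unfold extD
  rw [dif_pos d.2]

/-- inner product against a charge supported on `D`. [folklore] -/
theorem ip_extD_left (u : Dsub L → ℂ) (F : Cfg L → ℂ) :
    ip L (extD L u) F = ∑ d : Dsub L, (starRingEnd ℂ) (u d) * F d.1 := by
  classical
  unfold ip
  have h1 : ∑ c : Cfg L, (starRingEnd ℂ) (extD L u c) * F c
      = ∑ c ∈ Finset.univ.filter (fun c : Cfg L => InD L c = true), (starRingEnd ℂ) (extD L u c) * F c := by
    rw [Finset.sum_filter]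
    refine Finset.sum_congr rfl fun c _ => ?_
    unfold extD
    split_ifs <;> simp
  rw [h1, Finset.sum_subtype (Finset.univ.filter fun c : Cfg L => InD L c = true) (p := fun c => InD L c = true)
    (by intro c; simp)]
  refine Finset.sum_congr rfl fun d _ => ?_
  unfold extD
  rw [dif_pos d.2]

/-- [folklore] -/
theorem Gapply_sub (T : ℝ) (A B : Cfg L → ℂ) (c : Cfg L) :
    Gapply L T (fun d => A d - B d) c = Gapply L T A c - Gapply L T B c := by
  unfold Gapply; rw [← Finset.sum_sub_distrib]; refine Finset.sum_congr rfl fun c' _ => ?_; ring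

/-- `P u = e_D` (`T < 2ε₁`, `L ≥ 4`). [folklore] -/
theorem Pmat_kreinU (hL : 4 ≤ L) {T : ℝ} (hT : T < 2 * eps1 L) (R : Cfg L → ℂ) :
    Pmat L T *ᵥ kreinU L T R = traceD L T R := by
  unfold kreinU
  rw [Matrix.mulVec_mulVec, Matrix.mul_nonsing_inv _ (isUnit_iff_ne_zero.mpr (det_P_ne_zero L hL hT)),
    Matrix.one_mulVec]

/-- `G_T z` on the fibre is the `D`-sum `Σ_d G(c,d) u_d`; on `D` it reproduces the trace `e_D`. [folklore] -/
theorem Gapply_kreinZ_D (hL : 4 ≤ L) {T : ℝ} (hT : T < 2 * eps1 L) (R : Cfg L → ℂ) (d : Dsub L) :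
    Gapply L T (kreinZ L T R) d.1 = Gapply L T R d.1 := by
  unfold kreinZ
  rw [Gapply_extD]
  have h := congrFun (Pmat_kreinU L hL hT R) d
  simp only [Matrix.mulVec, dotProduct] at h
  unfold Pmat at h
  rw [h]; rfl

/-! ## `Y = G^D R` vanishes on `D`, is orthogonal to the poles, and is the reduced saddle residual on `S` -/

/-- **`G^D R` vanishes on the hard core.** [folklore] -/
theorem GDapply_D (hL : 4 ≤ L) {T : ℝ} (hT : T < 2 * eps1 L) (R : Cfg L → ℂ) (c : Cfg L) (hc : InD L c = true) :
    GDapply L T R c = 0 := by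
  unfold GDapply
  rw [Gapply_sub, Gapply_kreinZ_D L hL hT R ⟨c, hc⟩, sub_self]

/-- every pole wave is a pole plane wave. [folklore] -/
theorem poleWave_eq_pw (j : Fin 3) :
    ∃ k : Tor L × Tor L, IsPoleK1 L k.1 k.2 = true ∧ poleWave L j = pw L k.1 k.2 := by
  have p0 : IsPoleK1 L 0 0 = true := (isPoleK1_iff L (0, 0)).2 (Or.inl rfl)
  have p1 : IsPoleK1 L (K1 L) 0 = true := (isPoleK1_iff L (K1 L, 0)).2 (Or.inr (Or.inl rfl))
  have p2 : IsPoleK1 L 0 (K1 L) = true := (isPoleK1_iff L (0, K1 L)).2 (Or.inr (Or.inr rfl))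
  have h0 : poleWave L 0 = pw L 0 0 := funext fun c => (poleWave_eq L c).1
  have h1 : poleWave L 1 = pw L (K1 L) 0 := funext fun c => (poleWave_eq L c).2.1
  have h2 : poleWave L 2 = pw L 0 (K1 L) := funext fun c => (poleWave_eq L c).2.2
  fin_cases j
  · exact ⟨((0 : Tor L), (0 : Tor L)), p0, h0⟩
  · exact ⟨(K1 L, (0 : Tor L)), p1, h1⟩
  · exact ⟨((0 : Tor L), K1 L), p2, h2⟩

/-- the resolvent range is orthogonal to the pole waves. [folklore] -/
theorem ip_poleWave_Gapply (T : ℝ) (F : Cfg L → ℂ) (j : Fin 3) : ip L (poleWave L j) (Gapply L T F) = 0 := by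
  obtain ⟨k, hk, hj⟩ := poleWave_eq_pw L j
  rw [hj, ip_pw_Gapply]
  unfold gcoef; simp [hk]

/-- **`G^D R ⟂` the three pole waves.** [folklore] -/
theorem ip_poleWave_GDapply (T : ℝ) (R : Cfg L → ℂ) (j : Fin 3) : ip L (poleWave L j) (GDapply L T R) = 0 := by
  unfold GDapply; exact ip_poleWave_Gapply L T _ j

/-- **on the shell `Y_s = (G_T R)_s − (B P⁻¹ e_D)_s`** (the Schur-reduced saddle residual). [folklore] -/
theorem GDapply_S_eq (T : ℝ) (R : Cfg L → ℂ) (s : Ssub L) :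
    GDapply L T R s.1 = Gapply L T R s.1 - (Bmat L T *ᵥ ((Pmat L T)⁻¹ *ᵥ traceD L T R)) s := by
  unfold GDapply
  rw [Gapply_sub]
  congr 1
  unfold kreinZ
  rw [Gapply_extD]
  simp only [Matrix.mulVec, dotProduct]
  rfl

/-! ## `⟨Y, (H₀ − E) Y⟩ = ⟨Y, R⟩ ≤ G[R, R]` -/

/-- a function orthogonal to the pole waves is orthogonal to every pole projection. [folklore] -/
theorem ip_PiPole_of_orth (hL : 2 ≤ L) {Y : Cfg L → ℂ} (hY : ∀ j : Fin 3, ip L (poleWave L j) Y = 0)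
    (F : Cfg L → ℂ) : ip L Y (PiPole L F) = 0 := by
  have h0 : poleWave L 0 = pw L 0 0 := funext fun c => (poleWave_eq L c).1
  have h1 : poleWave L 1 = pw L (K1 L) 0 := funext fun c => (poleWave_eq L c).2.1
  have h2 : poleWave L 2 = pw L 0 (K1 L) := funext fun c => (poleWave_eq L c).2.2
  have a0 : ip L Y (pw L 0 0) = 0 := by
    rw [← conj_ip, ← h0, hY 0, map_zero]
  have a1 : ip L Y (pw L (K1 L) 0) = 0 := by
    rw [← conj_ip, ← h1, hY 1, map_zero]
  have a2 : ip L Y (pw L 0 (K1 L)) = 0 := by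
    rw [← conj_ip, ← h2, hY 2, map_zero]
  set α := ip L (pw L 0 0) F with hα
  set β := ip L (pw L (K1 L) 0) F with hβ
  set γ := ip L (pw L 0 (K1 L)) F with hγ
  have hP : PiPole L F = fun c => (1 / ((L : ℂ) ^ 2) ^ 2) *
      (α * pw L 0 0 c + β * pw L (K1 L) 0 c + γ * pw L 0 (K1 L) c) := by
    funext c; rw [PiPole_eq L hL, pw_pole₀, pw_pole₁, pw_pole₂, mul_one]
  rw [hP]
  have e : ip L Y (fun c => (1 / ((L : ℂ) ^ 2) ^ 2) * (α * pw L 0 0 c + β * pw L (K1 L) 0 c + γ * pw L 0 (K1 L) c))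
      = (1 / ((L : ℂ) ^ 2) ^ 2) * (α * ip L Y (pw L 0 0) + β * ip L Y (pw L (K1 L) 0) + γ * ip L Y (pw L 0 (K1 L))) := by
    unfold ip
    rw [Finset.mul_sum, Finset.mul_sum, Finset.mul_sum, ← Finset.sum_add_distrib, ← Finset.sum_add_distrib,
      Finset.mul_sum]
    refine Finset.sum_congr rfl fun c _ => ?_; ring
  rw [e, a0, a1, a2]; ring

/-- `Y ⟂ z`: the correction charge lives on `D`, where `Y` vanishes. [folklore] -/
theorem ip_GDapply_kreinZ (hL : 4 ≤ L) {T : ℝ} (hT : T < 2 * eps1 L) (R : Cfg L → ℂ) :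
    ip L (GDapply L T R) (kreinZ L T R) = 0 := by
  unfold kreinZ
  rw [← conj_ip, ip_extD_left]
  rw [Finset.sum_eq_zero, map_zero]
  intro d _
  rw [GDapply_D L hL hT R d.1 d.2, mul_zero]

/-- **`⟨Y, (H₀ − E) Y⟩ = ⟨Y, R⟩`** for `Y = G^D_T R`, `E = ε₁ + T` (`T < 2ε₁`, `L ≥ 4`). [folklore] -/
theorem ip_GD_H0E (hL : 4 ≤ L) {T : ℝ} (hT : T < 2 * eps1 L) (R : Cfg L → ℂ) :
    ip L (GDapply L T R) (fun c => H0apply L (K1 L) (GDapply L T R) c - ((eps1 L + T : ℝ) : ℂ) * GDapply L T R c)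
      = ip L (GDapply L T R) R := by
  have hL2 : 2 ≤ L := by omega
  have hpt : (fun c => H0apply L (K1 L) (GDapply L T R) c - ((eps1 L + T : ℝ) : ℂ) * GDapply L T R c)
      = fun c => (R c - kreinZ L T R c) - PiPole L (fun d => R d - kreinZ L T R d) c := by
    funext c; unfold GDapply; rw [H0E_Gapply L hL hT]
  rw [hpt, ip_sub_right, ip_sub_right, ip_PiPole_of_orth L hL2 (ip_poleWave_GDapply L T R), ip_GDapply_kreinZ L hL hT]
  ring

/-- **`Re⟨Y, R⟩ = Re G[R,R] − Re⟨u, P u⟩`** (Krein: `G − G^D = G 1_D P⁻¹ 1_D G`). [folklore] -/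
theorem ip_GD_R_eq (hL : 4 ≤ L) {T : ℝ} (hT : T < 2 * eps1 L) (R : Cfg L → ℂ) :
    ip L (GDapply L T R) R = Gform L T R R - star (kreinU L T R) ⬝ᵥ Pmat L T *ᵥ kreinU L T R := by
  unfold GDapply
  rw [ip_Gapply_left, Gform_eq_ip]
  have e1 : ip L (fun c => R c - kreinZ L T R c) (Gapply L T R)
      = ip L R (Gapply L T R) - ip L (kreinZ L T R) (Gapply L T R) := by
    unfold ip; rw [← Finset.sum_sub_distrib]; refine Finset.sum_congr rfl fun c _ => ?_; rw [map_sub]; ring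
  rw [e1]
  congr 1
  unfold kreinZ
  rw [ip_extD_left, Pmat_kreinU L hL hT R]
  simp only [dotProduct, Pi.star_apply, Complex.star_def]
  rfl

/-- **`G^D ≤ G`:** `Re⟨Y, R⟩ ≤ Re G[R, R]`. [folklore] -/
theorem re_ip_GD_R_le (hL : 4 ≤ L) {T : ℝ} (hT : T < 2 * eps1 L) (R : Cfg L → ℂ) :
    (ip L (GDapply L T R) R).re ≤ (Gform L T R R).re := by
  rw [ip_GD_R_eq L hL hT, Complex.sub_re]
  have := re_P_nonneg L hL hT (kreinU L T R)
  linarith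

/-! ## The ladder term -/

/-- a shell sum of a nonnegative function is at most the full sum. [folklore] -/
theorem sum_Ssub_le (g : Cfg L → ℝ) (hg : ∀ c, 0 ≤ g c) : ∑ s : Ssub L, g s.1 ≤ ∑ c : Cfg L, g c := by
  classical
  rw [← Finset.sum_subtype (Finset.univ.filter fun c : Cfg L => InS L c = true) (p := fun c => InS L c = true)
    (by intro c; simp) g]
  exact Finset.sum_le_sum_of_subset_of_nonneg (Finset.filter_subset _ _) fun c _ _ => hg c

/-- **mode-by-mode Temple factor on the pole complement** (§290(b)): for `Y ⟂` poles and `0 ≤ E = ε₁ + T < 3ε₁`,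
`Re⟨Y, H₀Y⟩ ≤ (3ε₁/(2ε₁ − T))·Re⟨Y, (H₀ − E)Y⟩`. [folklore] -/
theorem re_H0_le_kappa (hL : 4 ≤ L) {T : ℝ} (hT : T < 2 * eps1 L) (hE : 0 ≤ eps1 L + T) (Y : Cfg L → ℂ)
    (hY : ∀ j : Fin 3, ip L (poleWave L j) Y = 0) :
    (ip L Y (H0apply L (K1 L) Y)).re
      ≤ (3 * eps1 L / (2 * eps1 L - T)) *
          ((ip L Y (H0apply L (K1 L) Y)).re - (eps1 L + T) * (ip L Y Y).re) := by
  have hg0 : 0 < 2 * eps1 L - T := by linarith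
  have hgap := poleComplementGap_holds L hL Y hY
  have hN := ip_self_nonneg L Y
  set A := (ip L Y (H0apply L (K1 L) Y)).re with hA
  set Nn := (ip L Y Y).re with hNn
  have key : A * (2 * eps1 L - T) ≤ 3 * eps1 L * (A - (eps1 L + T) * Nn) := by
    nlinarith [mul_nonneg hE (sub_nonneg.mpr hgap)]
  calc A = A * (2 * eps1 L - T) / (2 * eps1 L - T) := by field_simp
    _ ≤ 3 * eps1 L * (A - (eps1 L + T) * Nn) / (2 * eps1 L - T) := div_le_div_of_nonneg_right key hg0.le
    _ = (3 * eps1 L / (2 * eps1 L - T)) * (A - (eps1 L + T) * Nn) := by ring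

/-- **LADDER BOUND** (§284(b)(i)–(iv) with `κ_E`): for `Y = G^D_T R`, `0 ≤ ε₁ + T`, `T < 2ε₁`, `0 ≤ Δ`, `L ≥ 4`,
`Σ_S ΔW|Y_s|² ≤ Δ·(3ε₁/(2ε₁ − T))·Re⟨Y, R⟩`. [folklore] -/
theorem ladder_bound (hL : 4 ≤ L) {T : ℝ} (hT : T < 2 * eps1 L) (hE : 0 ≤ eps1 L + T) {Δ : ℝ} (hΔ : 0 ≤ Δ)
    (R : Cfg L → ℂ) :
    ∑ s : Ssub L, (Δ * (Wcount L s.1 : ℝ)) * ‖GDapply L T R s.1‖ ^ 2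
      ≤ Δ * (3 * eps1 L / (2 * eps1 L - T)) * (ip L (GDapply L T R) R).re := by
  set Y := GDapply L T R with hYdef
  have hY0 : ∀ c, InD L c = true → Y c = 0 := fun c hc => GDapply_D L hL hT R c hc
  have horth : ∀ j : Fin 3, ip L (poleWave L j) Y = 0 := fun j => ip_poleWave_GDapply L T R j
  -- (i) shell sum ≤ full weighted sum
  have h1 : ∑ s : Ssub L, (Δ * (Wcount L s.1 : ℝ)) * ‖Y s.1‖ ^ 2 ≤ Δ * ∑ c : Cfg L, (Wcount L c : ℝ) * ‖Y c‖ ^ 2 := by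
    rw [Finset.mul_sum]
    have := sum_Ssub_le L (fun c => Δ * ((Wcount L c : ℝ) * ‖Y c‖ ^ 2)) (fun c => by positivity)
    refine le_trans (le_of_eq ?_) this
    refine Finset.sum_congr rfl fun s _ => ?_; ring
  -- (ii) shell ≤ Dirichlet form
  have h2 := shellDirichletBound_holds L Y hY0
  -- (iii) Temple factor on the pole complement
  have h3 := re_H0_le_kappa L hL hT hE Y horth
  -- (iv) ⟨Y,(H₀−E)Y⟩ = ⟨Y,R⟩
  have h4 : (ip L Y (H0apply L (K1 L) Y)).re - (eps1 L + T) * (ip L Y Y).re = (ip L Y R).re := by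
    have e := congrArg Complex.re (ip_GD_H0E L hL hT R)
    rw [← hYdef, ip_sub_right] at e
    rw [← e, Complex.sub_re]
    congr 1
    have : ip L Y (fun c => ((eps1 L + T : ℝ) : ℂ) * Y c) = ((eps1 L + T : ℝ) : ℂ) * ip L Y Y := by
      unfold ip; rw [Finset.mul_sum]; refine Finset.sum_congr rfl fun c _ => ?_; ring
    rw [this, Complex.re_ofReal_mul]
  rw [h4] at h3
  have hκ : 0 ≤ 3 * eps1 L / (2 * eps1 L - T) := by
    have := eps1_pos L hL; apply div_nonneg <;> linarith
  calc ∑ s : Ssub L, (Δ * (Wcount L s.1 : ℝ)) * ‖Y s.1‖ ^ 2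
      ≤ Δ * ∑ c : Cfg L, (Wcount L c : ℝ) * ‖Y c‖ ^ 2 := h1
    _ ≤ Δ * (ip L Y (H0apply L (K1 L) Y)).re := mul_le_mul_of_nonneg_left h2 hΔ
    _ ≤ Δ * ((3 * eps1 L / (2 * eps1 L - T)) * (ip L Y R).re) := mul_le_mul_of_nonneg_left h3 hΔ
    _ = Δ * (3 * eps1 L / (2 * eps1 L - T)) * (ip L Y R).re := by ring

end Summit.HubbardSuperconductivity.HubbardSuperconductivity.Theorems.AnisotropyChord.Transfer.Fibre3

end
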